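import Mathlib.RingTheory.Regular.RegularSequence
import Literature.RingTheory.TightClosure.TightClosure
import Summits.ResolutionOfSingularities.ResolutionOfSingularities.Theorems.FrobeniusLadderFRationalModificationExchange
import HarnessLib

/-!
# Power lift for tightly closed parameter ideals (crux `FrobeniusLadder.FRationalModification`)

Stub `stub_powerLift` of the skeleton `Sketch` for crux stmt-ResolutionOfSingularities-15316
(route `ResolutionOfSingularities/FrobeniusLadder`, rung 3: F-rational models): in a Noetherian
local domain `(R, 𝔪)` of prime characteristic `p` and dimension `d + 1` which is Cohen–Macaulay in
the sense that every system of parameters is a weakly regular sequence, if the parameter ideal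
`(a, u)` (`u : Fin d → R`, `rad (a, u) = 𝔪`) is tightly closed then so is `(aᵏ, u)` for every
`k ≥ 1`.

Proof (Fedder–Watanabe 1989, proof of Prop. 2.2; colon capturing): induction on `k`. For
`y ∈ (a^{k+1}, u)^* ⊆ (a, u)^* = (a, u)` write `y = α a + β` with `β ∈ (u)`; then
`α a ∈ (a^{k+1}, u)^*`, and a witness `c ≠ 0` gives, for every `q = p^e`,
`a^q (c α^q - λ a^{kq}) ∈ (u^q)`. Since `u^q, a^q` is a system of parameters, hence a weakly regular
sequence, `a^q` is a non-zero-divisor modulo `(u^q)`, so `c α^q ∈ (a^{kq}) + (u^q) = (a^k, u)^[q]`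
for all `q`, i.e. `α ∈ (a^k, u)^* = (a^k, u)` by the induction hypothesis, whence
`y = α a + β ∈ (a^{k+1}, u)`.

Vocabulary: `Literature.RingTheory.TightClosure` (`frobeniusPower`, `tightClosure`,
`IsTightlyClosed`, `IsSystemOfParameters`) and Mathlib's `RingTheory.Sequence.IsWeaklyRegular`.
The colon-capturing lemma (`b x ∈ (v) ⇒ x ∈ (v)` for a parameter ideal `(b, v)`) is reused from the
sibling support file of stub `stub_exchange`
(`…Theorems.FRationalModification.Exchange.mem_span_of_mul_mem`).
-/

-- single-problem summit: the doubled namespace component `ResolutionOfSingularities` is forced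
set_option linter.dupNamespace false

namespace Summit.ResolutionOfSingularities.ResolutionOfSingularities.Theorems.FRationalModification.PowerLift

open IsLocalRing RingTheory.Sequence Literature.RingTheory.TightClosure

section Helpers

variable {R : Type*} [CommRing R]

/-! ## Frobenius powers of parameter ideals -/

/-- The Frobenius power of `(b, v)` is `(b^q, v^q)` (`q = p^e`). [folklore] -/
theorem frobeniusPower_span_insert_range (p : ℕ) [ExpChar R p] (e : ℕ) (b : R) {n : ℕ}
    (v : Fin n → R) :
    frobeniusPower (p ^ e) (Ideal.span (insert b (Set.range v))) =
      Ideal.span (insert (b ^ p ^ e) (Set.range fun i => v i ^ p ^ e)) := by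
  rw [frobeniusPower_span, Set.image_insert_eq, ← Set.range_comp]
  rfl

/-- A Frobenius power `I^[q]`, `q ≠ 0`, has the same radical as `I`. [folklore] -/
theorem radical_frobeniusPower {q : ℕ} (hq : q ≠ 0) (I : Ideal R) :
    (frobeniusPower q I).radical = I.radical :=
  le_antisymm (Ideal.radical_mono (frobeniusPower_le hq I))
    (Ideal.radical_le_radical_iff.mpr fun _ hx => Ideal.mem_radical_iff.mpr
      ⟨q, pow_mem_frobeniusPower hx⟩)

/-! ## The inductive step -/

/-- **Inductive step**: with `R`, `a`, `u` as in `stub_powerLift`, if `(a, u)` and `(aᵏ, u)` are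
tightly closed then so is `(a^{k+1}, u)`. For `y = α a + β ∈ (a^{k+1}, u)^*` (`β ∈ (u)`, using
`(a^{k+1}, u)^* ⊆ (a, u)^* = (a, u)`), a witness `c ≠ 0` of `α a ∈ (a^{k+1}, u)^*` gives
`a^q (c α^q - λ (aᵏ)^q) ∈ (u^q)` for every `q = p^e`, so `c α^q ∈ (aᵏ, u)^[q]` by colon capturing
(`Exchange.mem_span_of_mul_mem` for the parameter ideal `(a^q, u^q) = (a, u)^[q]`), i.e.
`α ∈ (aᵏ, u)^* = (aᵏ, u)` and `y ∈ (a^{k+1}, u)`.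
[cite: FedderWatanabe1989, proof of Prop. 2.2] -/
theorem isTightlyClosed_span_insert_pow_succ (p : ℕ) [Fact p.Prime] [IsDomain R] [IsLocalRing R]
    [CharP R p]
    (hCM : ∀ ⦃n : ℕ⦄ (s : Fin n → R), IsSystemOfParameters s → IsWeaklyRegular R (List.ofFn s))
    {d : ℕ} (hd : ringKrullDim R = ((d + 1 : ℕ) : WithBot ℕ∞)) {a : R} {u : Fin d → R}
    (hau : (Ideal.span (insert a (Set.range u))).radical = maximalIdeal R)
    (htc : IsTightlyClosed p (Ideal.span (insert a (Set.range u)))) {k : ℕ}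
    (ih : IsTightlyClosed p (Ideal.span (insert (a ^ k) (Set.range u)))) :
    IsTightlyClosed p (Ideal.span (insert (a ^ (k + 1)) (Set.range u))) := by
  have hp : p ≠ 0 := (Fact.out : p.Prime).ne_zero
  set U : Ideal R := Ideal.span (Set.range u)
  have hU1 : U ≤ Ideal.span (insert a (Set.range u)) := Ideal.span_mono (Set.subset_insert _ _)
  have hUk1 : U ≤ Ideal.span (insert (a ^ (k + 1)) (Set.range u)) :=
    Ideal.span_mono (Set.subset_insert _ _)
  have hk1_le : Ideal.span (insert (a ^ (k + 1)) (Set.range u)) ≤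
      Ideal.span (insert a (Set.range u)) := by
    refine Ideal.span_le.mpr (Set.insert_subset ?_ (Ideal.subset_span.trans hU1))
    exact Ideal.pow_mem_of_mem _ (Ideal.subset_span (Set.mem_insert _ _)) _ (Nat.succ_pos k)
  refine (isTightlyClosed_iff_le p).mpr fun y hy => ?_
  -- `y ∈ (a, u)`: `y = α a + β`, `β ∈ (u)`
  have hy1 : y ∈ Ideal.span (insert a (Set.range u)) := htc.le (tightClosure_mono p hk1_le hy)
  obtain ⟨α, β, hβ, rfl⟩ := Ideal.mem_span_insert.mp hy1
  -- `α a ∈ (a^{k+1}, u)^*`, with witness `c`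
  have hαa : α * a ∈ tightClosure p (Ideal.span (insert (a ^ (k + 1)) (Set.range u))) :=
    (Submodule.add_mem_iff_left _ (le_tightClosure p _ (hUk1 hβ))).mp hy
  obtain ⟨c, hc0, hc⟩ := (mem_tightClosure_iff_of_isDomain p).mp hαa
  -- `α ∈ (a^k, u)^*`
  have hα : α ∈ tightClosure p (Ideal.span (insert (a ^ k) (Set.range u))) := by
    refine (mem_tightClosure_iff_of_isDomain p).mpr ⟨c, hc0, fun e => ?_⟩
    have hce := hc e
    rw [frobeniusPower_span_insert_range] at hce ⊢
    obtain ⟨lam, v, hv, heq⟩ := Ideal.mem_span_insert.mp hce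
    -- `a^q (c α^q - lam (a^k)^q) = v ∈ (u^q)`
    have hmul : a ^ p ^ e * (c * α ^ p ^ e - lam * (a ^ k) ^ p ^ e) ∈
        Ideal.span (Set.range fun i => u i ^ p ^ e) := by
      have h : a ^ p ^ e * (c * α ^ p ^ e - lam * (a ^ k) ^ p ^ e) = v := by
        rw [eq_sub_of_add_eq' heq.symm]
        ring
      rw [h]
      exact hv
    -- the parameter ideal `(a^q, u^q) = (a, u)^[q]` has radical `𝔪`
    have hrad : (Ideal.span (insert (a ^ p ^ e) (Set.range fun i => u i ^ p ^ e))).radical =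
        maximalIdeal R := by
      rw [← frobeniusPower_span_insert_range p e a u, radical_frobeniusPower (pow_ne_zero e hp),
        hau]
    have hcap := Exchange.mem_span_of_mul_mem hCM hd hrad hmul
    exact Ideal.mem_span_insert.mpr ⟨lam, _, hcap, by ring⟩
  -- `α ∈ (a^k, u)`, so `α a + β ∈ (a^{k+1}, u)`
  obtain ⟨μ, ν, hν, hαeq⟩ := Ideal.mem_span_insert.mp (ih.le hα)
  refine Ideal.mem_span_insert.mpr ⟨μ, ν * a + β, add_mem (Ideal.mul_mem_right _ _ hν) hβ, ?_⟩
  rw [hαeq]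
  ring

end Helpers

/-! ## The theorem -/

/-- STUB `stub_powerLift` of crux `FRationalModification` (line `Sketch`) — **raising one parameter
to a power keeps the parameter ideal tightly closed**: `(R, 𝔪)` a Noetherian local domain of
characteristic `p` and dimension `d + 1` in which every system of parameters is a weakly regular
sequence (Cohen–Macaulay); if the parameter ideal `(a, u)` (`rad (a, u) = 𝔪`) is tightly closed
then so is `(aᵏ, u)` for every `k ≥ 1`. Induction on `k` from `k = 1`
(`isTightlyClosed_span_insert_pow_succ`, colon capturing along the system of parameters
`u^q, a^q`). [cite: FedderWatanabe1989, proof of Prop. 2.2] -/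
theorem stub_powerLift (p : ℕ) [Fact p.Prime] {R : Type*} [CommRing R] [IsDomain R]
    [IsNoetherianRing R] [IsLocalRing R] [CharP R p]
    (hCM : ∀ ⦃n : ℕ⦄ (s : Fin n → R), IsSystemOfParameters s → IsWeaklyRegular R (List.ofFn s))
    {d : ℕ} (hd : ringKrullDim R = ((d + 1 : ℕ) : WithBot ℕ∞)) {a : R} {u : Fin d → R}
    (hau : (Ideal.span (insert a (Set.range u))).radical = maximalIdeal R)
    (htc : IsTightlyClosed p (Ideal.span (insert a (Set.range u)))) {k : ℕ} (hk : 0 < k) :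
    IsTightlyClosed p (Ideal.span (insert (a ^ k) (Set.range u))) := by
  induction k, hk using Nat.le_induction with
  | base => rw [pow_one]; exact htc
  | succ k _ ih => exact isTightlyClosed_span_insert_pow_succ p hCM hd hau htc ih

end Summit.ResolutionOfSingularities.ResolutionOfSingularities.Theorems.FRationalModification.PowerLift
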